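import Literature.AlgebraicGeometry.Motives.CartierDivisorMultiplicityOfIrreducibleSupport
import Literature.AlgebraicGeometry.Motives.CartierDivisorIdealSheafPullback
import Literature.AlgebraicGeometry.Morphisms.SubschemeIntegral
import Literature.AlgebraicGeometry.Morphisms.ReducedInducedPiece
import HarnessLib

/-!
# The ideal sheaf `𝒪_X(−D)` is an invariant of the divisor; divisors of multiplicity one cut reduced subschemes

Layer `Literature/AlgebraicGeometry/Motives` (namespace `….Motives.CartierDivisor`).  KERNEL ONLY (theorems; no definition,
no named fact, no instance, no `sorry`).

Görtz–Wedhorn, *Algebraic Geometry I*, Def. 11.20 (p. 301) and Remark 11.27 (p. 305): effective Cartier divisors on `X` "are" the closed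
subschemes `D ⊆ X` whose ideal `𝒪_X(−D)` is invertible; two tuples `(U_i, f_i)`, `(V_j, g_j)` giving the same divisor
(Def. 11.20: `f_i g_j⁻¹ ∈ Γ(U_i ∩ V_j, 𝒪_X^×)`) give the same ideal.  In the tree's presentation (★ `Motives/CartierDivisor`:
`CartierDivisor.SameDivisor`; ★ `Motives/CartierDivisorIdealSheaf`: `CartierDivisor.IsEffective.idealSheaf`, on an affine `V` the
ideal `sectionIdeal D V` of sections `s` with `s / f_i` regular on `V ∩ U_i`) this file proves:

* §1 `CartierDivisor.SameDivisor.sectionIdeal_eq` — `sectionIdeal` is `SameDivisor`-invariant (no effectivity needed; the inclusion ★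
  `SameDivisor.sectionIdeal_le` and «same divisor ⇒ same ideal sheaf» ★ `SameDivisor.idealSheaf_eq` — the converse of ★
  `SameDivisor.of_idealSheaf_eq` — are in `Motives/CartierDivisorIdealSheafPullback`); `CartierDivisor.sameDivisor_iff_idealSheaf_eq`;
  `CartierDivisor.SameDivisor.idealSheaf_eq_of_ofIsEffectiveCartier` (`D ≈ [I] ⇒ 𝒪(−D) = I`, ★ `idealSheaf_ofIsEffectiveCartier`).
* §2 (regular integral Noetherian `X`, Hartshorne II.6.11 for ONE prime divisor) **`CartierDivisor.IsEffective.
  idealSheaf_eq_primeDivisorIdeal_of_forall_eq_one`**: an effective `D` with irreducible support `X ∖ X_1 = cl{η}` which is NOT a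
  proper multiple (`D ≈ m • E ⇒ m = 1`) has `𝒪(−D) = 𝓘_{cl η}` (★ `exists_sameDivisor_smul_of_support_eq_closure` gives
  `D ≈ a • [cl η]`, `a ≥ 1`; the hypothesis forces `a = 1`); hence its closed subscheme `Z(D) = V(𝒪(−D))` is the REDUCED (indeed
  integral) closed subscheme with underlying set the support (`isReduced_subscheme_idealSheaf_of_forall_eq_one`,
  `isIntegral_subscheme_idealSheaf_of_forall_eq_one`, `range_subschemeι_idealSheaf`, `coheight_eq_one_of_support_eq_closure`,
  `sameDivisor_ofIsEffectiveCartier_primeDivisorIdeal_of_forall_eq_one`).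

Use (cell `hodgecm-mathlib`, D-0151; crux HLiu418 = stmt-HodgeConjecture-24832, road G4 → VI-8 (F-P2), Step I of [Lange2023] Lemma
4.4.4 on road (E): the junction «a principal-polarisation theta divisor `Θ` IS `1 · W̃_{g−1}`, so `Z(Θ)` is the integral `W̃_{g−1}`»;
the multiplicity-one hypothesis is discharged there by ★ `AbelianVariety.eq_one_of_isPrincipalPolarizationDivisor_smul`).
COUNT-NEUTRAL.  HC_CM is proved only modulo the 7 printed citations until rung 0 closes; this file moves no book by itself.

## References
* [GortzWedhorn2020] U. Görtz, T. Wedhorn, *Algebraic Geometry I*, 2nd ed. (2020), Def. 11.20 (p. 301), Remark 11.27 (p. 305),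
  Thm. 11.40 (2), Prop. 3.27 (p. 79).
* [Hartshorne1977] R. Hartshorne, *Algebraic Geometry* (1977), II.6 Prop. 6.11 and Remark 6.11.2 (pp. 141–142); II Example 3.2.6.
-/

set_option autoImplicit false

noncomputable section

open CategoryTheory AlgebraicGeometry TopologicalSpace Opposite

universe u

namespace Literature.AlgebraicGeometry.Motives

namespace CartierDivisor

open RatFn Literature.AlgebraicGeometry.Resolution Literature.AlgebraicGeometry.Morphisms

variable {X : Scheme.{u}} [IsIntegral X] {D E : CartierDivisor X}

/-! ## §1 `𝒪_X(−D)` depends only on the divisor -/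

/-- **`sectionIdeal` is an invariant of the divisor**: same divisor ⇒ the same ideals of sections of `𝒪_X(−D)` over every affine open.
[cite: GortzWedhorn2020, Def. 11.20 (p. 301)] -/
theorem SameDivisor.sectionIdeal_eq (h : D.SameDivisor E) (V : X.affineOpens) : D.sectionIdeal V = E.sectionIdeal V :=
  le_antisymm (h.sectionIdeal_le V) (h.symm.sectionIdeal_le V)

/-- **Two effective presentations define the same divisor iff they have the same ideal sheaf.**
[cite: GortzWedhorn2020, Remark 11.27 (p. 305)] -/
theorem sameDivisor_iff_idealSheaf_eq (hD : D.IsEffective) (hE : E.IsEffective) :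
    D.SameDivisor E ↔ hD.idealSheaf = hE.idealSheaf :=
  ⟨fun h => h.idealSheaf_eq hD hE, SameDivisor.of_idealSheaf_eq hD hE⟩

/-- Same divisor ⇒ same support of the ideal sheaf. [cite: GortzWedhorn2020, Remark 11.27 (p. 305)] -/
theorem SameDivisor.support_idealSheaf_eq (h : D.SameDivisor E) (hD : D.IsEffective) (hE : E.IsEffective) :
    hD.idealSheaf.support = hE.idealSheaf.support := by
  rw [h.idealSheaf_eq hD hE]

/-- Same divisor ⇒ same support `X ∖ X_1` (for effective presentations). [cite: GortzWedhorn2020, Remark 11.27 (p. 305)] -/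
theorem SameDivisor.compl_nonvanishing_one_eq (h : D.SameDivisor E) (hD : D.IsEffective) (hE : E.IsEffective) :
    (D.nonvanishing 1)ᶜ = (E.nonvanishing 1)ᶜ := by
  rw [← hD.coe_support_idealSheaf, ← hE.coe_support_idealSheaf, h.idealSheaf_eq hD hE]

/-- **`D ≈ [I] ⇒ 𝒪_X(−D) = I`**: an effective divisor which is the same divisor as the Cartier divisor of an invertible ideal sheaf `I`
(★ `ofIsEffectiveCartier`) has ideal sheaf `I` (★ `idealSheaf_ofIsEffectiveCartier`). [cite: GortzWedhorn2020, Remark 11.27 (p. 305)] -/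
theorem SameDivisor.idealSheaf_eq_of_ofIsEffectiveCartier (hD : D.IsEffective) {I : X.IdealSheafData} (hI : IsEffectiveCartier I)
    (h : D.SameDivisor (ofIsEffectiveCartier I hI)) : hD.idealSheaf = I := by
  rw [h.idealSheaf_eq hD (isEffective_ofIsEffectiveCartier I hI), idealSheaf_ofIsEffectiveCartier]

/-- `D ≈ m • [I] ⇒ 𝒪_X(−D) = I ^ m`. [cite: GortzWedhorn2020, Remark 11.27 (p. 305)] -/
theorem SameDivisor.idealSheaf_eq_pow_of_smul_ofIsEffectiveCartier (hD : D.IsEffective) {I : X.IdealSheafData}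
    (hI : IsEffectiveCartier I) {m : ℕ} (h : D.SameDivisor (m • ofIsEffectiveCartier I hI)) : hD.idealSheaf = I ^ m := by
  rw [h.idealSheaf_eq hD ((isEffective_ofIsEffectiveCartier I hI).smul m), (isEffective_ofIsEffectiveCartier I hI).idealSheaf_smul,
    idealSheaf_ofIsEffectiveCartier]

/-- **The closed subscheme `Z(D)` of an effective divisor has underlying set the support `X ∖ X_1`** (Mathlib `range_subschemeι` with ★
`coe_support_idealSheaf`). [cite: GortzWedhorn2020, Remark 11.27 (p. 305)] -/
theorem IsEffective.range_subschemeι_idealSheaf (hD : D.IsEffective) :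
    Set.range hD.idealSheaf.subschemeι = (D.nonvanishing 1)ᶜ := by
  rw [Scheme.IdealSheafData.range_subschemeι, hD.coe_support_idealSheaf]

/-! ## §2 Effective divisors of multiplicity one with irreducible support -/

section Regular

variable [IsNoetherian X]

/-- The generic point of the irreducible support of an effective Cartier divisor on a regular integral Noetherian scheme has
codimension one (Hartshorne II.6.11: the support of a non-zero effective Cartier divisor is a union of prime divisors).
[cite: Hartshorne1977, II.6 Prop. 6.11 and Remark 6.11.2 (pp. 141–142)] -/
theorem IsEffective.coheight_eq_one_of_support_eq_closure (hX : Scheme.IsRegular X) (hD : D.IsEffective) {η : X}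
    (hη : (D.nonvanishing 1)ᶜ = closure {η}) : Order.coheight η = 1 :=
  (hD.exists_sameDivisor_smul_of_support_eq_closure hX hη).1

/-- **An effective Cartier divisor of multiplicity one with irreducible support has ideal sheaf the prime divisor ideal of its
support**: on a regular integral Noetherian `X`, if `D ≥ 0`, `X ∖ X_1 = cl{η}` and `D` is not a proper multiple of any divisor
(`D ≈ m • E ⇒ m = 1`), then `𝒪_X(−D) = 𝓘_{cl η}`.  By ★ `exists_sameDivisor_smul_of_support_eq_closure`, `D ≈ a • [cl η]` with
`a ≥ 1`; the hypothesis gives `a = 1`, and `𝒪(−[𝓘]) = 𝓘` (★ `idealSheaf_ofIsEffectiveCartier`).  Hartshorne II.6.11 (`CaCl = Cl` on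
the locally factorial `X`; one prime divisor with coefficient `1`). [cite: Hartshorne1977, II.6 Prop. 6.11 and Remark 6.11.2 (pp. 141–142)]
[cite: GortzWedhorn2020, Thm. 11.40 (2)] -/
theorem IsEffective.idealSheaf_eq_primeDivisorIdeal_of_forall_eq_one (hX : Scheme.IsRegular X) (hD : D.IsEffective) {η : X}
    (hη : (D.nonvanishing 1)ᶜ = closure {η}) (hone : ∀ (E : CartierDivisor X) (m : ℕ), 0 < m → D.SameDivisor (m • E) → m = 1) :
    hD.idealSheaf = primeDivisorIdeal η := by
  obtain ⟨h1, a, ha, hDa⟩ := hD.exists_sameDivisor_smul_of_support_eq_closure hX hη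
  have ha1 : a = 1 := hone _ a ha hDa
  subst ha1
  rw [one_smul] at hDa
  exact hDa.idealSheaf_eq_of_ofIsEffectiveCartier hD _

/-- Under the hypotheses of `idealSheaf_eq_primeDivisorIdeal_of_forall_eq_one`, `D` is the same divisor as the prime divisor `[cl η]`
of its support. [cite: Hartshorne1977, II.6 Prop. 6.11 and Remark 6.11.2 (pp. 141–142)] -/
theorem IsEffective.sameDivisor_ofIsEffectiveCartier_primeDivisorIdeal_of_forall_eq_one (hX : Scheme.IsRegular X)
    (hD : D.IsEffective) {η : X} (hη : (D.nonvanishing 1)ᶜ = closure {η})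
    (hone : ∀ (E : CartierDivisor X) (m : ℕ), 0 < m → D.SameDivisor (m • E) → m = 1) :
    D.SameDivisor (ofIsEffectiveCartier (primeDivisorIdeal η)
      (isEffectiveCartier_primeDivisorIdeal_of_isRegular hX (hD.coheight_eq_one_of_support_eq_closure hX hη))) :=
  SameDivisor.of_idealSheaf_eq hD (isEffective_ofIsEffectiveCartier _ _) (by
    rw [hD.idealSheaf_eq_primeDivisorIdeal_of_forall_eq_one hX hη hone, idealSheaf_ofIsEffectiveCartier])

/-- **The closed subscheme of an effective divisor of multiplicity one with irreducible support is reduced**: `Z(D) = V(𝒪(−D)) =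
V(𝓘_{cl η})` is the reduced induced closed subscheme on `cl{η}` (★ `isReduced_subscheme_vanishingIdeal`).
[cite: Hartshorne1977, II Example 3.2.6] [cite: Hartshorne1977, II.6 Prop. 6.11 and Remark 6.11.2 (pp. 141–142)] -/
theorem IsEffective.isReduced_subscheme_idealSheaf_of_forall_eq_one (hX : Scheme.IsRegular X) (hD : D.IsEffective) {η : X}
    (hη : (D.nonvanishing 1)ᶜ = closure {η}) (hone : ∀ (E : CartierDivisor X) (m : ℕ), 0 < m → D.SameDivisor (m • E) → m = 1) :
    IsReduced hD.idealSheaf.subscheme := by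
  rw [hD.idealSheaf_eq_primeDivisorIdeal_of_forall_eq_one hX hη hone]
  exact Morphisms.isReduced_subscheme_vanishingIdeal _

/-- **The closed subscheme of an effective divisor of multiplicity one with irreducible support is integral** (reduced with
irreducible underlying space `cl{η}`; ★ `Morphisms.isIntegral_subscheme`). [cite: GortzWedhorn2020, Prop. 3.27 (p. 79)]
[cite: Hartshorne1977, II.6 Prop. 6.11 and Remark 6.11.2 (pp. 141–142)] -/
theorem IsEffective.isIntegral_subscheme_idealSheaf_of_forall_eq_one (hX : Scheme.IsRegular X) (hD : D.IsEffective) {η : X}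
    (hη : (D.nonvanishing 1)ᶜ = closure {η}) (hone : ∀ (E : CartierDivisor X) (m : ℕ), 0 < m → D.SameDivisor (m • E) → m = 1) :
    IsIntegral hD.idealSheaf.subscheme := by
  rw [hD.idealSheaf_eq_primeDivisorIdeal_of_forall_eq_one hX hη hone]
  refine isIntegral_subscheme _ (le_antisymm (fun U => ?_) (Scheme.IdealSheafData.le_radical _)) ?_
  · rw [primeDivisorIdeal, Scheme.IdealSheafData.radical_ideal, Scheme.IdealSheafData.vanishingIdeal_ideal]
    exact (PrimeSpectrum.isRadical_vanishingIdeal _).radical_le_iff.mpr le_rfl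
  · rw [coe_support_primeDivisorIdeal]
    exact isIrreducible_singleton.closure

end Regular

end CartierDivisor

end Literature.AlgebraicGeometry.Motives

end
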